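import Mathlib
import Summits.MatrixMultiplication.MatrixMultiplication.Theorems.OrbitHarmonicsHostsAbelianNoGoDefs

/-!
# `AbelianNoGo` — weight vectors and levels in the orbit-harmonics ring

Route `MatrixMultiplication/OrbitHarmonicsHosts`, support item `stmt-MatrixMultiplication-5456`
(`AbelianNoGo`); continues the vocabulary file `OrbitHarmonicsHostsAbelianNoGoDefs`.  Everything is phrased
upstairs in `ℂ[x]`, modulo the ideal `J = grIdeal` of the orbit-harmonics ring `gr(P) = ℂ[x]/J`:

* `mem_grIdeal_of_isHomogeneous`, `mem_grIdeal_of_sub_mem`: a homogeneous polynomial lies in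
  `J` if it vanishes on the orbit, or if it agrees on the orbit with a polynomial of smaller
  degree;
* `phi_spec`: on a free orbit every character `χ` has a homogeneous lift `phi χ` of degree
  `lev χ` (average a low-degree interpolant over `Γ` and take its top component);
* `exists_sub_C_mul_phi_mem` (**W**): every weight vector of weight `χ` is `≡ c · phi χ (mod J)` —
  the weight spaces of `gr(P)` are the lines `ℂ f_χ`, `f_χ` in degree `lev χ`;
* `lev_mul_le`, `phi_mul_sub_phi_mem`, `phi_mul_mem` (**M**): levels are subadditive and
  `f_χ f_ψ ≡ [lev (χψ) = lev χ + lev ψ] f_{χψ} (mod J)`.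

This is the structure "`gr ≅` regular module with one-dimensional weight spaces `f_χ` in single
degrees `ℓ(χ)`, `f_χ f_ψ ≠ 0` iff `ℓ(χ+ψ) = ℓ(χ)+ℓ(ψ)`" of the route's proof sketch
(Garsia–Procesi style orbit harmonics), in the minimal form the no-go theorem needs.
-/

-- single-conjunct summit: the mandated namespace repeats `MatrixMultiplication`.
set_option linter.dupNamespace false

namespace Summit.MatrixMultiplication.MatrixMultiplication.Theorems

namespace AbelianNoGo

open MvPolynomial

variable {Γ : Type*} [CommGroup Γ] {d : ℕ} {ρV : Γ →* GL (Fin d) ℂ} {v : Fin d → ℂ}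

/-! ### Homogeneous polynomials in `J` -/

/-- A homogeneous polynomial vanishing on the orbit lies in `J` (it is its own top form).
[folklore] -/
lemma mem_grIdeal_of_isHomogeneous {f : MvPolynomial (Fin d) ℂ} {k : ℕ}
    (hf : f ∈ vanishingIdeal ℂ (Set.range (pt ρV v))) (hh : f.IsHomogeneous k) :
    f ∈ grIdeal ρV v := by
  by_cases h0 : f = 0
  · rw [h0]
    exact Ideal.zero_mem _
  · refine Ideal.subset_span ⟨f, hf, ?_⟩
    change homogeneousComponent f.totalDegree f = f
    rw [hh.totalDegree h0, homogeneousComponent_eq_self hh]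

/-- A homogeneous polynomial of degree `k` which agrees on the orbit with a polynomial of degree
`< k` lies in `J` (it is the top form of the difference). [folklore] -/
lemma mem_grIdeal_of_sub_mem {h g : MvPolynomial (Fin d) ℂ} {k : ℕ} (hh : h.IsHomogeneous k)
    (hg : g.totalDegree < k) (hI : h - g ∈ vanishingIdeal ℂ (Set.range (pt ρV v))) :
    h ∈ grIdeal ρV v := by
  by_cases h0 : h = 0
  · rw [h0]
    exact Ideal.zero_mem _
  · have hdeg : (h - g).totalDegree = k := by
      have h1 : (-g).totalDegree < h.totalDegree := by
        rw [totalDegree_neg, hh.totalDegree h0]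
        exact hg
      rw [sub_eq_add_neg, totalDegree_add_eq_left_of_totalDegree_lt h1, hh.totalDegree h0]
    have hLF : homogeneousComponent (h - g).totalDegree (h - g) = h := by
      rw [hdeg, map_sub, homogeneousComponent_eq_self hh, homogeneousComponent_eq_zero k g hg,
        sub_zero]
    have hmem : homogeneousComponent (h - g).totalDegree (h - g) ∈ grIdeal ρV v :=
      Ideal.subset_span ⟨h - g, hI, rfl⟩
    rwa [hLF] at hmem

/-! ### The homogeneous lifts `phi χ` -/

/-- On a free orbit every character has a homogeneous lift of degree `lev χ`: average a degree
`≤ lev χ` interpolant of `χ` over `Γ` against `χ⁻¹` (this keeps the value `χ` on the orbit and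
makes it a weight vector), then its homogeneous components of degree `< lev χ` vanish on the
orbit (minimality of the level) and those of degree `> lev χ` vanish identically, so the top
component still restricts to `χ`. [folklore] -/
theorem exists_phi [Fintype Γ] (hinj : Function.Injective (pt ρV v)) (χ : Γ →* ℂˣ) :
    ∃ φ : MvPolynomial (Fin d) ℂ, φ.IsHomogeneous (lev ρV v χ) ∧ ev ρV v φ = fn χ := by
  classical
  obtain ⟨f, hfdeg, hfev⟩ := mem_filt_iff.1 (fn_mem_filt_lev hinj χ)
  set ℓ := lev ρV v χ with hℓ
  set f₁ : MvPolynomial (Fin d) ℂ :=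
    (Fintype.card Γ : ℂ)⁻¹ • ∑ g : Γ, (fn χ g)⁻¹ • subst ρV g f with hf₁
  -- `f₁` is a weight vector of weight `χ`
  have hw : ∀ g, subst ρV g f₁ = fn χ g • f₁ := by
    intro g
    simp only [hf₁, map_smul, map_sum, subst_subst]
    rw [smul_comm]
    congr 1
    rw [Finset.smul_sum]
    refine Fintype.sum_equiv (Equiv.mulRight g) _ _ fun h => ?_
    simp only [Equiv.coe_mulRight, smul_smul, fn_apply_mul]
    congr 1
    field_simp [fn_ne_zero χ g, fn_ne_zero χ h]
  -- `f₁` restricts to `χ`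
  have hev₁ : ev ρV v f₁ = fn χ := by
    simp only [hf₁, map_smul, map_sum, ev_subst, hfev]
    funext h'
    simp only [Pi.smul_apply, Finset.sum_apply, smul_eq_mul, fn_apply_mul]
    have e : ∀ g : Γ, (fn χ g)⁻¹ * (fn χ g * fn χ h') = fn χ h' := fun g => by
      field_simp [fn_ne_zero χ g]
    simp only [e, Finset.sum_const, Finset.card_univ, nsmul_eq_mul]
    field_simp [(Nat.cast_ne_zero.2 Fintype.card_ne_zero : (Fintype.card Γ : ℂ) ≠ 0)]
  -- components away from `ℓ` restrict to `0`
  have hcomp : ∀ k, k ≠ ℓ → ev ρV v (homogeneousComponent k f₁) = 0 := by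
    intro k hk
    rcases lt_or_gt_of_ne hk with hlt | hgt
    · exact ev_eq_zero_of_weight_of_lt (weight_homogeneousComponent hw k)
        (homogeneousComponent_isHomogeneous k f₁).totalDegree_le hlt
    · have h0 : homogeneousComponent k f₁ = 0 := by
        simp only [hf₁, map_smul, map_sum, ← subst_homogeneousComponent,
          homogeneousComponent_eq_zero k f (hfdeg.trans_lt hgt), map_zero, smul_zero,
          Finset.sum_const_zero]
      rw [h0, map_zero]
  refine ⟨homogeneousComponent ℓ f₁, homogeneousComponent_isHomogeneous ℓ f₁, ?_⟩
  rw [← hev₁]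
  conv_rhs => rw [← sum_homogeneousComponent f₁]
  rw [map_sum, Finset.sum_eq_single ℓ (fun k _ hk => hcomp k hk) fun hℓ' => ?_]
  have hlt : f₁.totalDegree < ℓ := by
    simpa [Finset.mem_range, Nat.lt_succ_iff] using hℓ'
  rw [homogeneousComponent_eq_zero ℓ f₁ hlt, map_zero]

/-- `phi χ` is homogeneous of degree `lev χ` and restricts to `χ` on a free orbit. [folklore] -/
lemma phi_spec [Fintype Γ] (hinj : Function.Injective (pt ρV v)) (χ : Γ →* ℂˣ) :
    (phi ρV v χ).IsHomogeneous (lev ρV v χ) ∧ ev ρV v (phi ρV v χ) = fn χ := by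
  classical
  have h := exists_phi hinj χ
  rw [phi, dif_pos h]
  exact h.choose_spec

/-- `phi χ` is homogeneous of degree `lev χ`. [folklore] -/
lemma phi_isHomogeneous [Fintype Γ] (hinj : Function.Injective (pt ρV v)) (χ : Γ →* ℂˣ) :
    (phi ρV v χ).IsHomogeneous (lev ρV v χ) :=
  (phi_spec hinj χ).1

/-- `phi χ` restricts to `χ`. [folklore] -/
lemma ev_phi [Fintype Γ] (hinj : Function.Injective (pt ρV v)) (χ : Γ →* ℂˣ) :
    ev ρV v (phi ρV v χ) = fn χ :=
  (phi_spec hinj χ).2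

/-! ### (W) weight vectors are multiples of `phi χ` modulo `J` -/

/-- A *homogeneous* weight vector of weight `χ` is congruent to a multiple of `phi χ` modulo `J`:
below the level it vanishes on the orbit (minimality), at the level it differs from
`c · phi χ` by a homogeneous element of `I(P)`, above the level it agrees on the orbit with the
lower-degree polynomial `c · phi χ`. [folklore] -/
lemma exists_sub_C_mul_phi_mem_of_isHomogeneous [Fintype Γ] (hinj : Function.Injective (pt ρV v))
    {h : MvPolynomial (Fin d) ℂ} {k : ℕ} {χ : Γ →* ℂˣ} (hh : h.IsHomogeneous k)
    (hw : ∀ g, subst ρV g h = fn χ g • h) :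
    ∃ c : ℂ, h - C c * phi ρV v χ ∈ grIdeal ρV v := by
  have hI : h - C (ev ρV v h 1) * phi ρV v χ ∈ vanishingIdeal ℂ (Set.range (pt ρV v)) := by
    rw [mem_vanishingIdeal_iff_ev, map_sub, ← smul_eq_C_mul, map_smul, ev_phi hinj χ,
      ← ev_of_weight hw, sub_self]
  rcases lt_trichotomy k (lev ρV v χ) with hlt | heq | hgt
  · refine ⟨0, ?_⟩
    rw [map_zero, zero_mul, sub_zero]
    exact mem_grIdeal_of_isHomogeneous ((mem_vanishingIdeal_iff_ev h).2
      (ev_eq_zero_of_weight_of_lt hw hh.totalDegree_le hlt)) hh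
  · refine ⟨ev ρV v h 1, mem_grIdeal_of_isHomogeneous hI (hh.sub ?_)⟩
    rw [heq]
    exact (phi_isHomogeneous hinj χ).C_mul _
  · refine ⟨0, ?_⟩
    rw [map_zero, zero_mul, sub_zero]
    refine mem_grIdeal_of_sub_mem hh (lt_of_le_of_lt ?_ hgt) hI
    rw [← smul_eq_C_mul]
    exact (totalDegree_smul_le _ _).trans (phi_isHomogeneous hinj χ).totalDegree_le

/-- **(W)** Every weight vector of weight `χ` is congruent to a multiple of `phi χ` modulo `J`
(apply the homogeneous case to each homogeneous component). [folklore] -/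
theorem exists_sub_C_mul_phi_mem [Fintype Γ] (hinj : Function.Injective (pt ρV v))
    {f : MvPolynomial (Fin d) ℂ} {χ : Γ →* ℂˣ} (hw : ∀ g, subst ρV g f = fn χ g • f) :
    ∃ c : ℂ, f - C c * phi ρV v χ ∈ grIdeal ρV v := by
  classical
  have hk : ∀ k, ∃ c : ℂ, homogeneousComponent k f - C c * phi ρV v χ ∈ grIdeal ρV v := fun k =>
    exists_sub_C_mul_phi_mem_of_isHomogeneous hinj (homogeneousComponent_isHomogeneous k f)
      (weight_homogeneousComponent hw k)
  choose c hc using hk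
  refine ⟨∑ k ∈ Finset.range (f.totalDegree + 1), c k, ?_⟩
  have e : f - C (∑ k ∈ Finset.range (f.totalDegree + 1), c k) * phi ρV v χ =
      ∑ k ∈ Finset.range (f.totalDegree + 1), (homogeneousComponent k f - C (c k) * phi ρV v χ) := by
    rw [Finset.sum_sub_distrib, sum_homogeneousComponent, map_sum, Finset.sum_mul]
  rw [e]
  exact Ideal.sum_mem _ fun k _ => hc k

/-! ### (M) levels of products -/

/-- Levels are subadditive: `lev (χψ) ≤ lev χ + lev ψ` (`phi χ * phi ψ` restricts to `χψ`).
[folklore] -/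
lemma lev_mul_le [Fintype Γ] (hinj : Function.Injective (pt ρV v)) (χ ψ : Γ →* ℂˣ) :
    lev ρV v (χ * ψ) ≤ lev ρV v χ + lev ρV v ψ := by
  refine lev_le (mem_filt_iff.2 ⟨phi ρV v χ * phi ρV v ψ,
    ((phi_isHomogeneous hinj χ).mul (phi_isHomogeneous hinj ψ)).totalDegree_le, ?_⟩)
  rw [map_mul, ev_phi hinj, ev_phi hinj, fn_mul]

/-- **(M, additive case)** if `lev (χψ) = lev χ + lev ψ` then `phi χ * phi ψ ≡ phi (χψ) (mod J)`.
[folklore] -/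
lemma phi_mul_sub_phi_mem [Fintype Γ] (hinj : Function.Injective (pt ρV v)) {χ ψ : Γ →* ℂˣ}
    (h : lev ρV v (χ * ψ) = lev ρV v χ + lev ρV v ψ) :
    phi ρV v χ * phi ρV v ψ - phi ρV v (χ * ψ) ∈ grIdeal ρV v := by
  refine mem_grIdeal_of_isHomogeneous ?_
    (((phi_isHomogeneous hinj χ).mul (phi_isHomogeneous hinj ψ)).sub
      (h ▸ phi_isHomogeneous hinj (χ * ψ)))
  rw [mem_vanishingIdeal_iff_ev, map_sub, map_mul, ev_phi hinj, ev_phi hinj, ev_phi hinj, fn_mul,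
    sub_self]

/-- **(M, strict case)** if `lev (χψ) < lev χ + lev ψ` then `phi χ * phi ψ ∈ J`. [folklore] -/
lemma phi_mul_mem [Fintype Γ] (hinj : Function.Injective (pt ρV v)) {χ ψ : Γ →* ℂˣ}
    (h : lev ρV v (χ * ψ) < lev ρV v χ + lev ρV v ψ) :
    phi ρV v χ * phi ρV v ψ ∈ grIdeal ρV v := by
  obtain ⟨g, hgdeg, hgev⟩ := mem_filt_iff.1 (fn_mem_filt_lev hinj (χ * ψ))
  refine mem_grIdeal_of_sub_mem ((phi_isHomogeneous hinj χ).mul (phi_isHomogeneous hinj ψ))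
    (hgdeg.trans_lt h) ?_
  rw [mem_vanishingIdeal_iff_ev, map_sub, map_mul, ev_phi hinj, ev_phi hinj, hgev, fn_mul, sub_self]

end AbelianNoGo

end Summit.MatrixMultiplication.MatrixMultiplication.Theorems
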